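import Summits.AtomisticToContinuum.Crystallization.Theorems.ThreeConeCertificateSlackRigidityPricedFloorsLayerFloor
import Summits.AtomisticToContinuum.Crystallization.Theorems.ThreeConeCertificateSlackRigidityPricedFloorsReadoff
import Summits.AtomisticToContinuum.Crystallization.Theorems.ThreeConeCertificateSlackRigidityLawPadding
import Summits.AtomisticToContinuum.Crystallization.Theorems.ThreeConeCertificateSlackRigidityLawPalmSplit
import Summits.AtomisticToContinuum.Crystallization.Theorems.ThreeConeCertificateSlackRigidityHcpAdmissible
import HarnessLib

/-!
# `SlackRigidity` (stmt-AtomisticToContinuum-11960), line `priced-floors-palm-exactification`: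
# the converse `PalmRigidity → FiniteLayerRigidity` — the weakest residual sits between 9224 and the crux

Lead c22.  Lead c21 landed the chain
`CoerciveTwoShellGap → NearFieldConvexity → LayerFloor → FiniteLayerRigidity → PalmRigidity → SlackRigidity`
(`…PricedFloorsLayerFloor`, p156040) and left as "expected but not proved" the converse
`PalmRigidity → FiniteLayerRigidity`.  This file proves it, so that the line's weakest one-scale residual
is pinned between item 9224 and the crux:

  `PalmRigidity ↔ FiniteLayerRigidity ∧ HcpOptimalInBox`     (`lms_palmRigidity_iff_finiteLayerRigidity_and_hcpOptimal`)
  `HcpOptimalInBox → (FiniteLayerRigidity ↔ SlackRigidity)`  (`lms_finiteLayerRigidity_iff_slackRigidity_of_hcpOptimal`)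

where `HcpOptimalInBox` is the second conjunct of the landed split
`PalmRigidity ↔ SlackRigidity ∧ HcpOptimalInBox` (`SlackRigidityLawPalmSplit`, lead c14): some relaxed hcp
with `(a, h) ∈ [1/2, 2]²` attains `⨅_Q e(Q)`.  So `FiniteLayerRigidity` is the crux AT ONE SCALE, not an
easier target: filing it as an item would gain nothing over 11960 ∧ (hcp attains the periodic minimum).

PROOF of `PalmRigidity → FiniteLayerRigidity` (`finiteLayerRigidity_of_rigidFor_hcp`).
`PalmRigidity` gives a crux witness and an optimal relaxed hcp in the box, which is then itself a
witness (`rigidFor_hcp_of_rigidFor`, c14) and is ADMISSIBLE LAYERING DATA (`lms_hcpOptimal_admissible`,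
this lead's certificate: `a ∈ [0.963, 0.976]`, `h/a ∈ (0.8148, 0.8250)`).  For admissible `(a, h)` the
set `A(hcpStacking a h)` is a layered set of item 13958's family (`layeredSet_eq_image`, c19), so a particle
that is `(2, η)`-GOOD for the template `hcp(a, h)` is `η`-layered at radius `2` (`layeredAt_of_good_hcp`).
If `FiniteLayerRigidity` failed at `(δ, η, b)`, there would be arbitrarily large `δ`-separated clusters with
energy `≤ #T e* + τ #T` for every `τ > 0` and more than `b #T` non-`η`-layered, hence `(2, η)`-bad,
particles; padded with ground states (`SlackRigidityLawPadding.not_rigidFor_of_badClusters`, c14) they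
refute `RigidFor (hcp(a, h))`.  The passage configuration ↔ enumerated cluster is relabelling bookkeeping
(`exists_cluster_of_config`).  All `[folklore]`.
-/

noncomputable section

open scoped BigOperators Topology
open MeasureTheory Filter Set
open Literature.Probability.Process
open Literature.MathematicalPhysics.StatisticalMechanics
open Summit.AtomisticToContinuum.Crystallization.Theses.ThreeConeCertificate (SlackRigidity)
open Summit.AtomisticToContinuum.Crystallization.Theses.PalmUnimodularRigidity (PalmRigidity)
open Summit.AtomisticToContinuum.Crystallization.Theorems.SlackRigidityNegative
  (E3 Good RigidFor slackRigidity_iff)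
open Summit.AtomisticToContinuum.Crystallization.Theorems.MinimiserShells.Negative.LoadBearing (eStar)
open Summit.AtomisticToContinuum.Crystallization.Theorems.SlackRigidityPricedFloors
  (layeredSet IsAdmissibleLayering LayeredAt)

namespace Summit.AtomisticToContinuum.Crystallization.Theorems.SlackRigidityFlrOfPalm

/-! ## Goodness for an admissible hcp template implies layeredness -/

/-- **A `(R, η)`-good particle for an admissible hcp template is `η`-layered at radius `2`** (`R ≥ 2`):
the matching isometry `A`, the translation `−x i`, and the data `(a, alternatingHagg, m ↦ m h)` present
`A(hcp(a, h).points)` as an admissible layered set (`layeredSet_eq_image`), and the two matching clauses of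
`Good` are the two clauses of `LayeredAt 2 2 η`. [folklore] -/
theorem layeredAt_of_good_hcp {a h : ℝ} (ha : a ≠ 0) (hh : h ≠ 0)
    (hadm : 47 / 50 ≤ a ∧ a ≤ 1 ∧ 39 / 50 * a ≤ h ∧ h ≤ 17 / 20 * a)
    {R η : ℝ} (hR : 2 ≤ R) {N : ℕ} {x : Fin N → E3} {i : Fin N}
    (hgood : Good (hcpPeriodicConfiguration ha hh) R η x i) :
    LayeredAt 2 2 η (Set.range x) (x i) := by
  obtain ⟨A, h1, h2⟩ := hgood
  have hL : layeredSet A a alternatingHagg (fun m : ℤ => (m : ℝ) * h) =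
      A '' (hcpPeriodicConfiguration ha hh).points := by
    rw [hcpPeriodicConfiguration_points,
      SlackRigidityPricedFloorsReadoff.layeredSet_eq_image A (fun _ => rfl) (fun _ => rfl)]
  have hdist : ∀ (j : Fin N) (p : E3), dist (x j + -x i) (A p) = dist (x j) (x i + A p) := by
    intro j p
    rw [dist_eq_norm, dist_eq_norm]
    congr 1
    abel
  refine ⟨A, -x i, a, alternatingHagg, fun m : ℤ => (m : ℝ) * h, ?_, ?_, ?_⟩
  · refine ⟨hadm.1, hadm.2.1, isHaggSeq_alternating, fun m => ?_⟩
    have hsp : (((m + 1 : ℤ) : ℝ) * h) - (m : ℝ) * h = h := by push_cast; ring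
    show 39 / 50 * a ≤ (((m + 1 : ℤ) : ℝ) * h) - (m : ℝ) * h ∧ (((m + 1 : ℤ) : ℝ) * h) - (m : ℝ) * h ≤ 17 / 20 * a
    rw [hsp]
    exact ⟨hadm.2.2.1, hadm.2.2.2⟩
  · rintro y ⟨j, rfl⟩ hyd
    obtain ⟨p, hp, hpd⟩ := h2 j (hyd.trans hR)
    refine ⟨A p, ?_, ?_⟩
    · rw [hL]
      exact ⟨p, hp, rfl⟩
    · rw [hdist]
      exact hpd
  · intro q hq hqd
    rw [hL] at hq
    obtain ⟨p, hp, rfl⟩ := hq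
    have hnorm : ‖p‖ ≤ R := by
      have : dist (A p) (x i + -x i) = ‖p‖ := by
        rw [add_neg_cancel, dist_zero_right, A.norm_map]
      linarith [this ▸ hqd]
    obtain ⟨j, hj⟩ := h1 p hp hnorm
    refine ⟨x j, ⟨j, rfl⟩, ?_⟩
    rw [hdist]
    exact hj

/-! ## Relabelling bookkeeping: a configuration and its enumerated cluster -/

/-- Relabelling along an equivalence of index types does not change the interaction energy. [folklore] -/
theorem interactionEnergy_comp_equiv' {M N : ℕ} (e : Fin M ≃ Fin N) (x : Fin N → E3) :
    interactionEnergy lennardJones (x ∘ e) = interactionEnergy lennardJones x := by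
  obtain rfl : M = N := Fin.equiv_iff_eq.1 ⟨e⟩
  exact interactionEnergy_comp_equiv lennardJones e x

/-- **Configuration ↔ enumerated cluster.**  An injective configuration `x : Fin N → ℝ³` and the
enumeration of its image cluster `T` have the same number of points, the same energy, and the same
number of `(R, ε)`-bad points for any template (the crux's `Good` is local matching of the recentred
point SET, `good_iff_image`). [folklore] -/
theorem exists_cluster_of_config {N : ℕ} {x : Fin N → E3} (hx : Function.Injective x)
    (P₀ : PeriodicConfiguration 3) (R ε : ℝ) :
    ∃ T : Finset E3, T.card = N ∧
      interactionEnergy lennardJones (fun i : Fin T.card => ((T.equivFin.symm i : T) : E3)) =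
        interactionEnergy lennardJones x ∧
      Nat.card {i : Fin N // ¬ Good P₀ R ε x i} =
        Nat.card {y : T // ¬ ∃ A : E3 →ₗᵢ[ℝ] E3,
          LocallyMatches R ε ((fun z : E3 => z - (y : E3)) '' (T : Set E3)) (A '' P₀.points)} := by
  classical
  set T : Finset E3 := Finset.univ.image x with hT
  have hcoe : (T : Set E3) = Set.range x := by
    rw [hT, Finset.coe_image, Finset.coe_univ, Set.image_univ]
  have hmem : ∀ y : E3, y ∈ Set.range x ↔ y ∈ T := fun y => by
    rw [← Finset.mem_coe, hcoe]
  -- the bijection `Fin N ≃ T`, `i ↦ x i`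
  let ρ : Fin N ≃ T := (Equiv.ofInjective x hx).trans (Equiv.subtypeEquivRight hmem)
  have hρ : ∀ i : Fin N, ((ρ i : T) : E3) = x i := fun i => rfl
  have hρ' : ∀ t : T, x (ρ.symm t) = (t : E3) := fun t => by
    rw [← hρ (ρ.symm t), ρ.apply_symm_apply]
  refine ⟨T, ?_, ?_, ?_⟩
  · rw [hT, Finset.card_image_of_injective _ hx, Finset.card_univ, Fintype.card_fin]
  · -- the enumeration is `x ∘ σ` for `σ = equivFin⁻¹ ∘ ρ⁻¹`
    have hcomp : (fun i : Fin T.card => ((T.equivFin.symm i : T) : E3)) =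
        x ∘ (T.equivFin.symm.trans ρ.symm) := by
      funext i
      simp only [Function.comp_apply, Equiv.trans_apply, hρ']
    rw [hcomp, interactionEnergy_comp_equiv']
  · refine Nat.card_congr (Equiv.subtypeEquiv ρ fun i => not_congr ?_)
    rw [SlackRigidityLawPadding.good_iff_image, hρ i, hcoe]

/-! ## `RigidFor (hcp)` with admissible data forces finite layer rigidity -/

/-- **Finite layer rigidity from a rigid admissible hcp template.**  If `hcp(a, h)` with admissible
`(a, h)` is a witness of the crux (`RigidFor`), then for all `δ, η, b > 0` there are `τ > 0`, `M` such
that every `δ`-separated configuration of `N ≥ M` points with `𝓔(x) ≤ N e* + τ N` has at most `b N`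
points that are not `η`-layered at radius `2`.  Otherwise the failing configurations are bad clusters in
the sense of `SlackRigidityLawPadding.not_rigidFor_of_badClusters` (non-layered ⇒ `(2, η)`-bad by
`layeredAt_of_good_hcp`), which padded with ground states refute `RigidFor`. [folklore] -/
theorem finiteLayerRigidity_of_rigidFor_hcp {a h : ℝ} (ha : a ≠ 0) (hh : h ≠ 0)
    (hadm : 47 / 50 ≤ a ∧ a ≤ 1 ∧ 39 / 50 * a ≤ h ∧ h ≤ 17 / 20 * a)
    (hrig : RigidFor (hcpPeriodicConfiguration ha hh)) :
    ∀ δ : ℝ, 0 < δ → ∀ η : ℝ, 0 < η → ∀ b : ℝ, 0 < b → ∃ τ : ℝ, 0 < τ ∧ ∃ M : ℕ,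
      ∀ (N : ℕ) (x : Fin N → E3), M ≤ N → (∀ i j : Fin N, i ≠ j → δ ≤ dist (x i) (x j)) →
        interactionEnergy lennardJones x ≤ (N : ℝ) * eStar + τ * N →
          (Nat.card {i : Fin N // ¬ LayeredAt 2 2 η (Set.range x) (x i)} : ℝ) ≤ b * N := by
  intro δ hδ η hη b hb
  by_contra hcon
  push Not at hcon
  refine SlackRigidityLawPadding.not_rigidFor_of_badClusters (hcpPeriodicConfiguration ha hh) 2 η b
    two_pos hη hb ?_ hrig
  intro η' M hη'
  obtain ⟨N, x, hMN, hsep, hE, hbad⟩ := hcon η' hη' M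
  have hx : Function.Injective x := by
    intro i j hij
    by_contra hne
    have := hsep i j hne
    rw [hij, dist_self] at this
    linarith
  obtain ⟨T, hcard, hTE, hTbad⟩ := exists_cluster_of_config hx (hcpPeriodicConfiguration ha hh) 2 η
  refine ⟨T, hcard ▸ hMN, ?_, ?_⟩
  · rw [hTE, hcard]
    exact hE
  · rw [← hTbad, hcard]
    have hmono : Nat.card {i : Fin N // ¬ LayeredAt 2 2 η (Set.range x) (x i)} ≤
        Nat.card {i : Fin N // ¬ Good (hcpPeriodicConfiguration ha hh) 2 η x i} := by
      refine Nat.card_le_card_of_injective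
        (fun i => ⟨i.1, fun hgood => i.2 (layeredAt_of_good_hcp ha hh hadm le_rfl hgood)⟩) ?_
      intro i j hij
      simpa [Subtype.ext_iff] using hij
    have hmono' : (Nat.card {i : Fin N // ¬ LayeredAt 2 2 η (Set.range x) (x i)} : ℝ) ≤
        Nat.card {i : Fin N // ¬ Good (hcpPeriodicConfiguration ha hh) 2 η x i} := by
      exact_mod_cast hmono
    linarith

/-! ## The registered sub-goals -/

/-- **Registered sub-goal `lms_finiteLayerRigidity_of_palmRigidity`** (stmt-AtomisticToContinuum-11960):
item 9224 `PalmRigidity` implies `FiniteLayerRigidity` — the converse of the landed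
`lms_palmRigidity_of_finiteLayerRigidity` (c21).  `PalmRigidity` = crux witness + optimal relaxed hcp in
the box (`palmRigidity_iff_slackRigidity_and_hcpOptimal`); the optimal hcp is itself a witness
(`rigidFor_hcp_of_rigidFor`) and admissible (`lms_hcpOptimal_admissible`); conclude by
`finiteLayerRigidity_of_rigidFor_hcp`. [folklore] -/
theorem lms_finiteLayerRigidity_of_palmRigidity : PalmRigidity → (∀ δ : ℝ, 0 < δ → ∀ η : ℝ, 0 < η → ∀ b : ℝ, 0 < b → ∃ τ : ℝ, 0 < τ ∧ ∃ M : ℕ, ∀ (N : ℕ) (x : Fin N → E3), M ≤ N → (∀ i j : Fin N, i ≠ j → δ ≤ dist (x i) (x j)) → interactionEnergy lennardJones x ≤ (N : ℝ) * eStar + τ * N → (Nat.card {i : Fin N // ¬ LayeredAt 2 2 η (Set.range x) (x i)} : ℝ) ≤ b * N) := by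
  intro hP
  obtain ⟨hS, a, h, ha, hh, ha1, ha2, hh1, hh2, hopt⟩ :=
    SlackRigidityLawPalmSplit.palmRigidity_iff_slackRigidity_and_hcpOptimal.1 hP
  obtain ⟨P₀, hP₀⟩ := slackRigidity_iff.1 hS
  have hrig := SlackRigidityLawPalmSplit.rigidFor_hcp_of_rigidFor hP₀ ha hh hopt
  have hadm := (SlackRigidityHcpAdmissible.lms_hcpOptimal_admissible a h ha hh ha1 ha2 hh1 hh2 hopt).2
  exact finiteLayerRigidity_of_rigidFor_hcp ha hh hadm hrig

/-- **Registered sub-goal `lms_palmRigidity_iff_finiteLayerRigidity_and_hcpOptimal`**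
(stmt-AtomisticToContinuum-11960): item 9224 is EXACTLY `FiniteLayerRigidity` plus "an optimal relaxed
hcp lies in the box" (→ this file and c14's split; ← c21's `lms_palmRigidity_of_finiteLayerRigidity`). [folklore] -/
theorem lms_palmRigidity_iff_finiteLayerRigidity_and_hcpOptimal : PalmRigidity ↔ (∀ δ : ℝ, 0 < δ → ∀ η : ℝ, 0 < η → ∀ b : ℝ, 0 < b → ∃ τ : ℝ, 0 < τ ∧ ∃ M : ℕ, ∀ (N : ℕ) (x : Fin N → E3), M ≤ N → (∀ i j : Fin N, i ≠ j → δ ≤ dist (x i) (x j)) → interactionEnergy lennardJones x ≤ (N : ℝ) * eStar + τ * N → (Nat.card {i : Fin N // ¬ LayeredAt 2 2 η (Set.range x) (x i)} : ℝ) ≤ b * N) ∧ (∃ a h : ℝ, ∃ ha : a ≠ 0, ∃ hh : h ≠ 0, 1 / 2 ≤ a ∧ a ≤ 2 ∧ 1 / 2 ≤ h ∧ h ≤ 2 ∧ (hcpPeriodicConfiguration ha hh).energyPerParticle lennardJones = (⨅ Q : PeriodicConfiguration 3, Q.energyPerParticle lennardJones)) :=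
  ⟨fun hP => ⟨lms_finiteLayerRigidity_of_palmRigidity hP,
      (SlackRigidityLawPalmSplit.palmRigidity_iff_slackRigidity_and_hcpOptimal.1 hP).2⟩,
    fun h => SlackRigidityPricedFloorsLayerFloor.lms_palmRigidity_of_finiteLayerRigidity h.1⟩

/-- **Registered sub-goal `lms_finiteLayerRigidity_iff_slackRigidity_of_hcpOptimal`**
(stmt-AtomisticToContinuum-11960): granted that an optimal relaxed hcp lies in the box (the second
conjunct of item 9224; a sharpening of item 11961 `KeplerBound`), `FiniteLayerRigidity` is EQUIVALENT
to the crux. [folklore] -/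
theorem lms_finiteLayerRigidity_iff_slackRigidity_of_hcpOptimal : (∃ a h : ℝ, ∃ ha : a ≠ 0, ∃ hh : h ≠ 0, 1 / 2 ≤ a ∧ a ≤ 2 ∧ 1 / 2 ≤ h ∧ h ≤ 2 ∧ (hcpPeriodicConfiguration ha hh).energyPerParticle lennardJones = (⨅ Q : PeriodicConfiguration 3, Q.energyPerParticle lennardJones)) → ((∀ δ : ℝ, 0 < δ → ∀ η : ℝ, 0 < η → ∀ b : ℝ, 0 < b → ∃ τ : ℝ, 0 < τ ∧ ∃ M : ℕ, ∀ (N : ℕ) (x : Fin N → E3), M ≤ N → (∀ i j : Fin N, i ≠ j → δ ≤ dist (x i) (x j)) → interactionEnergy lennardJones x ≤ (N : ℝ) * eStar + τ * N → (Nat.card {i : Fin N // ¬ LayeredAt 2 2 η (Set.range x) (x i)} : ℝ) ≤ b * N) ↔ SlackRigidity) := by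
  intro hopt
  constructor
  · exact SlackRigidityPricedFloorsLayerFloor.lms_slackRigidity_of_finiteLayerRigidity
  · intro hS
    exact lms_finiteLayerRigidity_of_palmRigidity
      (SlackRigidityLawPalmSplit.palmRigidity_iff_slackRigidity_and_hcpOptimal.2 ⟨hS, hopt⟩)

end Summit.AtomisticToContinuum.Crystallization.Theorems.SlackRigidityFlrOfPalm

end
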